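import Summits.ValiantsHypothesis.ValiantsHypothesis.Theses.FifoMatching
import Literature.Computability.AlgebraicComplexity.NestFreeMatchingPoly
import Literature.Computability.AlgebraicComplexity.StrassenDivisionElimination

/-!
# Crux `FifoMatching.NNDivisionHard` (stmt-ValiantsHypothesis-21181) is implied by the general
(cancellative) hardness of `NN` — Strassen's division elimination

Helper toward item stmt-ValiantsHypothesis-21181 (`--supports`), placing the new piece of the
`NNNotVP` division split (`NNNotVP ⟸ ZeroOneTransfer ∧ NNDivisionHard`, glue `nnNotVP_of_subs`):

* `nnDivisionHard_of_superQuasiPolyHard` — if the nest-free matching family is EVENTUALLY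
  super-quasi-polynomially hard for GENERAL arithmetic circuits over `ℂ`
  (`∀ c, ∃ n₀, ∀ n ≥ n₀, 2^((log₂ n + c)^c) < L_ℂ(NN_n)`, the a.e. quantitative form of the parent
  crux `NNNotVP`), then `NNDivisionHard` holds: every nonzero cofactor `h ≥ 0` has
  `2^((log₂ n + c)^c) < L₊(NN_n · h) + L₊(h)` for all large `n`.
* `exists_quasiPoly_complexity_of_not_nnDivisionHard` — the contrapositive KILL-LINK: a refutation of
  `NNDivisionHard` puts `NN_n` in quasi-polynomial COMPLEX circuit size for infinitely many `n`.

Mechanism: a monotone certificate `L₊(NN_n·h) + L₊(h) ≤ Q` is in particular a complex circuit with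
ONE division for `NN_n = (NN_n h)/h` (`complexity_map_le` along `ℝ≥0 → ℂ`), and Strassen's
*Vermeidung von Divisionen* (tree: `DivisionElimination.complexity_le_pow_four_of_mul_eq`, BCS 1997
Thm. (7.1) for one division) removes it at cost `(2Q + n + 4n² + 4)⁴`, which is again
quasi-polynomial (`quasiPoly_absorb`, `C = c + 40`).  So the monotone-with-division statement 21181 sits BELOW the
(a.e., quasi-polynomial) general hardness of `NN` and ABOVE nothing cancellative; the transfer
difficulty of the split is carried entirely by `ZeroOneTransfer`.

Honest framing: a placement / consistency result (no lower bound is proved; `NNDivisionHard`,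
`NNNotVP` and VP ≠ VNP remain OPEN).  Sorry-free; axioms `propext`, `Classical.choice`, `Quot.sound`.
-/

noncomputable section

-- Sub = Summit single-conjunct layout: the duplicated namespace component is mandated by the tree.
set_option linter.dupNamespace false

namespace Summit.ValiantsHypothesis.ValiantsHypothesis.Theorems.FifoMatching.NNDivisionHard.OfGeneralHardness

open MvPolynomial Literature.Computability.AlgebraicComplexity
open scoped NNReal BigOperators

/-! ### Arithmetic: the Strassen overhead is quasi-polynomial -/

/-- `n + 4n² + 4 ≤ 9 · 4^(log₂ n + 1)` (from `n < 2^(log₂ n + 1)`). [folklore] -/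
theorem poly_le_two_pow (n : ℕ) :
    n + 2 * n * (2 * n) + 4 ≤ 2 ^ (2 * Nat.log 2 n + 6) := by
  have hn : n < 2 ^ (Nat.log 2 n + 1) := Nat.lt_pow_succ_log_self one_lt_two n
  set X := 2 ^ (Nat.log 2 n + 1) with hX
  have hX1 : 1 ≤ X := Nat.one_le_two_pow
  have h1 : n + 2 * n * (2 * n) + 4 ≤ 9 * X ^ 2 := by nlinarith
  have h2 : 9 * X ^ 2 ≤ 16 * X ^ 2 := by nlinarith
  have h3 : 16 * X ^ 2 = 2 ^ (2 * Nat.log 2 n + 6) := by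
    rw [hX, ← pow_mul, show (16 : ℕ) = 2 ^ 4 by norm_num, ← pow_add]
    congr 1; ring
  omega

/-- Core of the absorption, with the logarithm abstracted: if `n + 4n² + 4 ≤ 2^(2ℓ+6)` then
`(2·2^E + n + 4n² + 4)⁴ ≤ 2^(4(E + 2ℓ + 8))`. [folklore] -/
theorem absorb_core (ℓ E n : ℕ) (hn : n + 2 * n * (2 * n) + 4 ≤ 2 ^ (2 * ℓ + 6)) :
    (2 * 2 ^ E + n + 2 * n * (2 * n) + 4) ^ 4 ≤ 2 ^ (4 * (E + 2 * ℓ + 8)) := by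
  have h1 : 2 * 2 ^ E = 2 ^ (E + 1) := by rw [pow_succ, mul_comm]
  have h3 : 2 ^ (E + 1) + 2 ^ (2 * ℓ + 6) ≤ 2 ^ (E + 1 + (2 * ℓ + 6) + 1) := by
    have ha : 2 ^ (E + 1) ≤ 2 ^ (E + 1 + (2 * ℓ + 6)) := Nat.pow_le_pow_right (by norm_num) (by omega)
    have hb : 2 ^ (2 * ℓ + 6) ≤ 2 ^ (E + 1 + (2 * ℓ + 6)) :=
      Nat.pow_le_pow_right (by norm_num) (by omega)
    rw [pow_succ]; omega
  have hbase : 2 * 2 ^ E + n + 2 * n * (2 * n) + 4 ≤ 2 ^ (E + 1 + (2 * ℓ + 6) + 1) := by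
    omega
  have h4 : (2 ^ (E + 1 + (2 * ℓ + 6) + 1)) ^ 4 = 2 ^ (4 * (E + 2 * ℓ + 8)) := by
    rw [← pow_mul]
    congr 1
    ring
  calc (2 * 2 ^ E + n + 2 * n * (2 * n) + 4) ^ 4 ≤ (2 ^ (E + 1 + (2 * ℓ + 6) + 1)) ^ 4 :=
        Nat.pow_le_pow_left hbase 4
    _ = 2 ^ (4 * (E + 2 * ℓ + 8)) := h4

/-- The exponent comparison `4((ℓ + c)^c + 2ℓ + 8) ≤ (ℓ + (c + 40))^(c + 40)`: an explicit
quasi-polynomial absorption (`(ℓ + C)^C ≥ (ℓ + C)² (ℓ + c)^c ≥ (1600 + 80ℓ)(ℓ + c)^c`). [folklore] -/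
theorem exponent_absorb (c ℓ : ℕ) :
    4 * ((ℓ + c) ^ c + 2 * ℓ + 8) ≤ (ℓ + (c + 40)) ^ (c + 40) := by
  have hP : 1 ≤ (ℓ + c) ^ c := by
    rcases Nat.eq_zero_or_pos c with rfl | hc
    · simp
    · exact Nat.one_le_pow _ _ (by omega)
  have h1 : (ℓ + (c + 40)) ^ (c + 2) ≤ (ℓ + (c + 40)) ^ (c + 40) :=
    Nat.pow_le_pow_right (by omega) (by omega)
  have h2 : (ℓ + (c + 40)) ^ 2 * (ℓ + c) ^ c ≤ (ℓ + (c + 40)) ^ (c + 2) := by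
    rw [pow_add, mul_comm]
    exact Nat.mul_le_mul_right _ (Nat.pow_le_pow_left (by omega) c)
  have h3a : 1600 + 80 * ℓ ≤ (ℓ + (c + 40)) ^ 2 := by
    have e : (40 + ℓ) ^ 2 ≤ (ℓ + (c + 40)) ^ 2 := Nat.pow_le_pow_left (by omega) 2
    have e' : (40 + ℓ) ^ 2 = 1600 + 80 * ℓ + ℓ * ℓ := by ring
    omega
  have h3 : (1600 + 80 * ℓ) * (ℓ + c) ^ c ≤ (ℓ + (c + 40)) ^ 2 * (ℓ + c) ^ c :=
    Nat.mul_le_mul_right _ h3a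
  generalize hPdef : (ℓ + c) ^ c = P at hP h3 ⊢
  have h4 : 4 * (P + 2 * ℓ + 8) ≤ (1600 + 80 * ℓ) * P := by
    have e1 : 80 * ℓ * 1 ≤ 80 * ℓ * P := Nat.mul_le_mul_left _ hP
    have e2 : (1600 + 80 * ℓ) * P = 1600 * P + 80 * ℓ * P := by ring
    rw [e2]
    generalize 80 * ℓ * P = R at e1 ⊢
    omega
  rw [hPdef] at h2
  exact h4.trans (h3.trans (h2.trans h1))

/-- **Quasi-polynomial absorption of the Strassen overhead**: with `C = c + 40`,
`(2 · 2^((log₂ n + c)^c) + n + 4n² + 4)⁴ ≤ 2^((log₂ n + C)^C)` for all `n`. [folklore] -/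
theorem quasiPoly_absorb (c n : ℕ) :
    (2 * 2 ^ ((Nat.log 2 n + c) ^ c) + n + 2 * n * (2 * n) + 4) ^ 4 ≤
      2 ^ ((Nat.log 2 n + (c + 40)) ^ (c + 40)) := by
  have hA := absorb_core (Nat.log 2 n) ((Nat.log 2 n + c) ^ c) n (poly_le_two_pow n)
  have hB : 4 * ((Nat.log 2 n + c) ^ c + 2 * Nat.log 2 n + 8) ≤
      (Nat.log 2 n + (c + 40)) ^ (c + 40) := exponent_absorb c (Nat.log 2 n)
  exact hA.trans (Nat.pow_le_pow_right (by norm_num) hB)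

/-! ### The placement theorem -/

/-- **General hardness of `NN` implies its division hardness** (Strassen's division elimination):
if `NN_n` (inlined over `ℂ` exactly as in the parent crux `NNNotVP`) eventually beats every
quasi-polynomial bound for GENERAL arithmetic circuits over `ℂ`, then crux `NNDivisionHard`
(stmt-ValiantsHypothesis-21181) holds.  Proof: a certificate `L₊(NN_n h) + L₊(h) ≤ 2^((log₂ n + c)^c)`
over `ℝ≥0` maps to complex circuits for `NN_n · h` and `h ≠ 0` (`complexity_map_le`), and
`DivisionElimination.complexity_le_pow_four_of_mul_eq` (`deg NN_n ≤ n`, `4n²` variables) bounds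
`L_ℂ(NN_n)` by `(2Q + n + 4n² + 4)⁴ ≤ 2^((log₂ n + C)^C)` (`quasiPoly_absorb`). [folklore] -/
theorem nnDivisionHard_of_superQuasiPolyHard
    (H : ∀ c : ℕ, ∃ n₀ : ℕ, ∀ n ≥ n₀, 2 ^ ((Nat.log 2 n + c) ^ c) <
      complexity (∑ M : Fin (2 * n) → Fin (2 * n),
        if ((∀ i, M (M i) = i) ∧ (∀ i, M i ≠ i) ∧ ∀ i j, i < j → j < M j → M j < M i → False) then
          ∏ i : Fin (2 * n), (if i < M i then MvPolynomial.X (i, M i) else 1)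
        else (0 : MvPolynomial (Fin (2 * n) × Fin (2 * n)) ℂ))) :
    Summit.ValiantsHypothesis.ValiantsHypothesis.Theses.FifoMatching.NNDivisionHard := by
  intro c
  obtain ⟨n₀, hn₀⟩ := H (c + 40)
  refine ⟨n₀, fun n hn hh hh0 => ?_⟩
  -- the route's inline `NN_n` over `ℝ≥0` is definitionally the library's `nestFreeMatchingPoly n ℝ≥0`
  show 2 ^ ((Nat.log 2 n + c) ^ c) < complexity (nestFreeMatchingPoly n ℝ≥0 * hh) + complexity hh
  have hlt : 2 ^ ((Nat.log 2 n + (c + 40)) ^ (c + 40)) < complexity (nestFreeMatchingPoly n ℂ) :=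
    hn₀ n hn
  by_contra hle
  push Not at hle
  -- transport the certificate to `ℂ`
  set φ : ℝ≥0 →+* ℂ := Complex.ofRealHom.comp NNReal.toRealHom with hφ
  have hφinj : Function.Injective φ := by
    intro x y hxy
    have h1 : ((x : ℝ) : ℂ) = ((y : ℝ) : ℂ) := hxy
    exact_mod_cast h1
  have hmaph : MvPolynomial.map φ hh ≠ 0 := by
    intro h0
    apply hh0
    apply MvPolynomial.map_injective φ hφinj
    rw [h0, map_zero]
  have hprod : nestFreeMatchingPoly n ℂ * MvPolynomial.map φ hh =
      MvPolynomial.map φ (nestFreeMatchingPoly n ℝ≥0 * hh) := by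
    rw [map_mul, map_nestFreeMatchingPoly]
  have hdeg : (nestFreeMatchingPoly n ℂ).totalDegree ≤ n := totalDegree_nestFreeMatchingPoly_le n
  have hS := DivisionElimination.complexity_le_pow_four_of_mul_eq hprod hmaph hdeg
  have c1 : complexity (MvPolynomial.map φ (nestFreeMatchingPoly n ℝ≥0 * hh)) ≤
      complexity (nestFreeMatchingPoly n ℝ≥0 * hh) := ArithCircuit.complexity_map_le φ _
  have c2 : complexity (MvPolynomial.map φ hh) ≤ complexity hh := ArithCircuit.complexity_map_le φ _
  have hcard : Fintype.card (Fin (2 * n) × Fin (2 * n)) = 2 * n * (2 * n) := by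
    rw [Fintype.card_prod, Fintype.card_fin]
  rw [hcard] at hS
  -- the Strassen bound is quasi-polynomial
  have hsum : complexity (MvPolynomial.map φ (nestFreeMatchingPoly n ℝ≥0 * hh)) +
      complexity (MvPolynomial.map φ hh) + n + 2 * n * (2 * n) + 4 ≤
      2 * 2 ^ ((Nat.log 2 n + c) ^ c) + n + 2 * n * (2 * n) + 4 := by omega
  have hbound : complexity (nestFreeMatchingPoly n ℂ) ≤ 2 ^ ((Nat.log 2 n + (c + 40)) ^ (c + 40)) :=
    hS.trans ((Nat.pow_le_pow_left hsum 4).trans (quasiPoly_absorb c n))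
  exact absurd (lt_of_lt_of_le hlt hbound) (lt_irrefl _)

/-- **Kill-link (contrapositive).**  If crux `NNDivisionHard` FAILS — some `c` and cofactors
`h_n ≠ 0` over `ℝ≥0` with `L₊(NN_n h_n) + L₊(h_n) ≤ 2^((log₂ n + c)^c)` along infinitely many `n` —
then `NN_n` has COMPLEX circuits of quasi-polynomial size `≤ 2^((log₂ n + C)^C)` for infinitely
many `n`: a refutation of 21181 would all but refute the parent crux `NNNotVP` (up to
quasi-polynomial vs polynomial and infinitely-often vs eventually), not merely the split. [folklore] -/
theorem exists_quasiPoly_complexity_of_not_nnDivisionHard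
    (hneg : ¬ Summit.ValiantsHypothesis.ValiantsHypothesis.Theses.FifoMatching.NNDivisionHard) :
    ∃ C : ℕ, ∀ n₀ : ℕ, ∃ n ≥ n₀,
      complexity (∑ M : Fin (2 * n) → Fin (2 * n),
        if ((∀ i, M (M i) = i) ∧ (∀ i, M i ≠ i) ∧ ∀ i j, i < j → j < M j → M j < M i → False) then
          ∏ i : Fin (2 * n), (if i < M i then MvPolynomial.X (i, M i) else 1)
        else (0 : MvPolynomial (Fin (2 * n) × Fin (2 * n)) ℂ)) ≤ 2 ^ ((Nat.log 2 n + C) ^ C) := by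
  by_contra hall
  push Not at hall
  exact hneg (nnDivisionHard_of_superQuasiPolyHard fun C => hall C)

end Summit.ValiantsHypothesis.ValiantsHypothesis.Theorems.FifoMatching.NNDivisionHard.OfGeneralHardness

end
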